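import Summits.BirchSwinnertonDyer.BirchSwinnertonDyer.Theorems.ManinLocalTwoThreeKummerCoverSubgroupTwo
import Summits.BirchSwinnertonDyer.BirchSwinnertonDyer.Theorems.ManinLocalTwoThreeShimuraQuotientLevelInstances
import Summits.BirchSwinnertonDyer.Rank1Residual.ManinAdditive.UDCKummerLineK
import Summits.BirchSwinnertonDyer.Rank1Residual.ManinAdditive.ShimuraKernel
import Summits.BirchSwinnertonDyer.BirchSwinnertonDyer.Theorems.ManinLocalTwoThreeShimuraQuotientConjugation
import Summits.BirchSwinnertonDyer.BirchSwinnertonDyer.Theorems.ManinLocalTwoThreeUnboundedDenominatorsWeightAlgIntOfCDT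
import Literature.NumberTheory.Automorphic.UnboundedDenominators
import HarnessLib

/-!
# THE THIRDING LINE FOR C3: Unbounded Denominators on the `3`-DIVISION COVER of the optimal parametrisation — `3 ∣ c₀ ⟹ Λ₁(f) = 3Λ₀(f)`,
# which NEVER happens; hence **C3 ⟸ CDT ∧ (thirding witness law)** — NO Kato fact, NO cusp fact, NO index law

Summit `BirchSwinnertonDyer`, route `ManinLocalTwoThree` (cell bsd-f2-manin), crux C3 `ManinPrimeToThreeAtNine` (stmt-BirchSwinnertonDyer-22968); lead p1 gen 18
(LEAD-MEMO v38: the `p = 3` twin of `…HalvingCoverUDC`).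

For a lattice-optimal `X₀(N)`-datum `D` of a globally minimal `W` with `3 ∣ c`, `c' := c/3`, the THIRD POINT `Q(τ) := c'·E_f(τ) mod Λ_W` (`3Q = φ(τ)`) moves under
`γ ∈ Γ₀(N)` by a `3`-torsion point, so every function of `Q` is modular for EXACTLY the **thirding cover group** `Γ^{(3)} := {γ ∈ Γ₀(N) : c·{∞,γ∞}_f ∈ 3Λ_W}`
— finite index (nine cosets), normal, type II (§1) — which contains `Γ₁(N)` iff `Λ₁(f) ⊆ 3Λ₀(f)`, i.e. (at `9 ∣ N`, where `3Λ₀ ⊆ Λ₁` by the traceless prime `3`)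
iff `Λ₁ = 3Λ₀` (INDEX `9`), and is NONCONGRUENCE otherwise (Kurth–Long, §2).  `t(Q)` has `q`-expansion `exp_W(c'·Σaₙqⁿ/n) ∈ ℤ⟦q⟧` (Honda at the integer `c'`), so
a pole-cleared multiple is a weight-`k` form for `Γ^{(3)}` with algebraic-integer coefficients — the **thirding witness** (§3, the one OPEN analytic stub);
Unbounded Denominators then forces INDEX `9` (§3) — but **index `9` never occurs** (tree `not_periodLatticeGamma1_eq_three_mul_periodLattice`, unconditional).
So **C3 ⟸ CDT ∧ (thirding witness law)** (§4), replacing the six printed stubs of `Lines/kato_shift_three.lean` v34 by ONE printed fact and ONE analytic stub.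

HONEST FRAMING: CONDITIONAL on CDT (printed) and on the OPEN thirding witness law (analytic bookkeeping, the `p = 3` port of the landed Kummer witness chains);
C3, Manin's conjecture and BSD are NOT proved.  No definitions, no sorry.
[cite: KurthLong2008, Def. 16 and Prop. 18] [cite: CalegariDimitrovTang2025, Thm. 1.0.1 and Remarks 58–59] [cite: Honda1970, Thm. 9] [cite: Manin1972, Thm. 1.6]
-/


set_option autoImplicit false
-- lint-debt: the directory name repeats the summit name (sibling precedent `ManinLocalTwoThreeKummerCoverSubgroupTwo.lean`)
set_option linter.dupNamespace false

noncomputable section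

open scoped MatrixGroups ModularForm PeriodPair Manifold
open CongruenceSubgroup Complex
open WeierstrassCurve Literature.NumberTheory.EllipticCurves Literature.NumberTheory.EllipticCurves.ModularForms
open Summit.BirchSwinnertonDyer.Rank1Residual.ManinAdditive
open Summit.BirchSwinnertonDyer.Rank1Residual.ManinAdditive.UDCKummerLine
open Summit.BirchSwinnertonDyer.Rank1Residual.ManinAdditive.UDCKummerLineK
open Summit.BirchSwinnertonDyer.Rank1Residual.ManinAdditive.ShimuraKernel

namespace Summit.BirchSwinnertonDyer.BirchSwinnertonDyer.Theorems.ManinLocalTwoThree.Thirding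

variable {W : WeierstrassCurve ℚ} [W.IsElliptic] [W.IsGloballyMinimal] {N : ℕ} [NeZero N]

/-! ## §1 The thirding cover group `Γ^{(3)} = {γ ∈ Γ₀(N) : c·{∞,γ∞}_f ∈ 3Λ_W}` -/

/-- Nine classes: every `x ∈ Λ_W` is `≡ iω₁ + jω₂ (mod 3Λ_W)` with `i, j ∈ {0,1,2}`. [folklore] -/
theorem exists_nine_classes (L : PeriodPair) :
    ∀ x ∈ L.lattice, ∃ i j : ℕ, i < 3 ∧ j < 3 ∧ ∃ ν ∈ L.lattice, x - (i : ℂ) * L.ω₁ - (j : ℂ) * L.ω₂ = 3 * ν := by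
  intro x hx
  obtain ⟨m, n, rfl⟩ := PeriodPair.mem_lattice.mp hx
  have em' : m = 3 * (m / 3) + m % 3 := by omega
  have en' : n = 3 * (n / 3) + n % 3 := by omega
  have hm0 : 0 ≤ m % 3 := by omega
  have hn0 : 0 ≤ n % 3 := by omega
  have em : (m : ℂ) = 3 * ((m / 3 : ℤ) : ℂ) + ((m % 3 : ℤ) : ℂ) := by exact_mod_cast em'
  have en : (n : ℂ) = 3 * ((n / 3 : ℤ) : ℂ) + ((n % 3 : ℤ) : ℂ) := by exact_mod_cast en'
  have hν : ((m / 3 : ℤ) : ℂ) * L.ω₁ + ((n / 3 : ℤ) : ℂ) * L.ω₂ ∈ L.lattice := PeriodPair.mem_lattice.mpr ⟨m / 3, n / 3, rfl⟩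
  refine ⟨(m % 3).toNat, (n % 3).toNat, by omega, by omega, _, hν, ?_⟩
  have hi : (((m % 3).toNat : ℕ) : ℂ) = ((m % 3 : ℤ) : ℂ) := by
    have h : ((m % 3).toNat : ℤ) = m % 3 := Int.toNat_of_nonneg hm0
    exact_mod_cast h
  have hj : (((n % 3).toNat : ℕ) : ℂ) = ((n % 3 : ℤ) : ℂ) := by
    have h : ((n % 3).toNat : ℤ) = n % 3 := Int.toNat_of_nonneg hn0
    exact_mod_cast h
  rw [hi, hj, em, en]; ring

omit [W.IsElliptic] [W.IsGloballyMinimal] in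
/-- **The thirding cover group.**  For any `X₀(N)`-datum `D`: `Γ^{(3)} = {γ ∈ Γ₀(N) : c·{∞,γ∞}_f ∈ 3Λ_W}` is a subgroup of `SL₂(ℤ)` inside `Γ₀(N)`, of
finite index (at most nine cosets), normal in `Γ₀(N)` (Manin's homomorphism `cuspSymbol_mul_holds`), containing every element of trace `±2` (zero
discriminant ⟹ zero period).  It is the monodromy group of the `3`-division cover `{(τ, Q) : 3Q = φ(τ)}` of `X₀(N)`.
[cite: KurthLong2008, Def. 16 (type II; shape)] [cite: Manin1972, Prop. 1.4 / Thm. 1.6] -/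
theorem exists_thirdingCoverSubgroup (D : ModularParametrizationData W N) :
    ∃ Γ : Subgroup SL(2, ℤ),
      (∀ γ : Gamma0 N, (γ : SL(2, ℤ)) ∈ Γ ↔ ∃ ν ∈ D.L.lattice, (D.c : ℂ) * cuspSymbol D.f γ = 3 * ν) ∧
      Γ ≤ Gamma0 N ∧ Γ.FiniteIndex ∧ (∀ g ∈ Gamma0 N, ∀ γ ∈ Γ, g * γ * g⁻¹ ∈ Γ) ∧
      (∀ γ ∈ Gamma0 N, (γ 0 0 + γ 1 1 = 2 ∨ γ 0 0 + γ 1 1 = -2) → γ ∈ Γ) := by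
  let Γ : Subgroup SL(2, ℤ) :=
    { carrier := {g | ∃ hg : g ∈ Gamma0 N, ∃ ν ∈ D.L.lattice, (D.c : ℂ) * cuspSymbol D.f ⟨g, hg⟩ = 3 * ν}
      one_mem' := by
        refine ⟨(Gamma0 N).one_mem, 0, zero_mem _, ?_⟩
        have : (⟨1, (Gamma0 N).one_mem⟩ : Gamma0 N) = 1 := rfl
        rw [this, cuspSymbol_one]; simp
      mul_mem' := by
        rintro g₁ g₂ ⟨hg₁, ν₁, hν₁, e₁⟩ ⟨hg₂, ν₂, hν₂, e₂⟩
        refine ⟨(Gamma0 N).mul_mem hg₁ hg₂, ν₁ + ν₂, add_mem hν₁ hν₂, ?_⟩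
        have : (⟨g₁ * g₂, (Gamma0 N).mul_mem hg₁ hg₂⟩ : Gamma0 N) = ⟨g₁, hg₁⟩ * ⟨g₂, hg₂⟩ := rfl
        rw [this, cuspSymbol_mul_holds, mul_add, e₁, e₂]; ring
      inv_mem' := by
        rintro g ⟨hg, ν, hν, e⟩
        refine ⟨(Gamma0 N).inv_mem hg, -ν, neg_mem hν, ?_⟩
        have : (⟨g⁻¹, (Gamma0 N).inv_mem hg⟩ : Gamma0 N) = ⟨g, hg⟩⁻¹ := rfl
        rw [this, cuspSymbol_inv, mul_neg, e]; ring }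
  have hmem : ∀ γ : Gamma0 N, (γ : SL(2, ℤ)) ∈ Γ ↔
      ∃ ν ∈ D.L.lattice, (D.c : ℂ) * cuspSymbol D.f γ = 3 * ν := fun γ ↦
    ⟨fun ⟨_, h⟩ ↦ h, fun h ↦ ⟨γ.2, h⟩⟩
  refine ⟨Γ, hmem, fun g hg ↦ hg.1, ?_, ?_, ?_⟩
  · -- FINITE INDEX: nine cosets over `Γ₀(N)` (classes of `Λ_W / 3Λ_W`)
    have h₁ : D.L.ω₁ ∈ (D.L.lattice : Set ℂ) := D.L.ω₁_mem_lattice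
    have h₂ : D.L.ω₂ ∈ (D.L.lattice : Set ℂ) := D.L.ω₂_mem_lattice
    -- every lattice vector `c·{∞,γ∞}` lies in `Λ_W`; we need two group elements whose periods hit the classes of `ω₁, ω₂` — when they exist.
    -- the image of `γ ↦ c·{∞,γ∞}` is `c·Λ₀ ⊆ Λ_W`; we bound the index by the nine classes directly.
    classical
    have hcl : ∀ γ : Gamma0 N, ∃ i j : ℕ, i < 3 ∧ j < 3 ∧ ∃ ν ∈ D.L.lattice,
        (D.c : ℂ) * cuspSymbol D.f γ - (i : ℂ) * D.L.ω₁ - (j : ℂ) * D.L.ω₂ = 3 * ν := fun γ ↦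
      exists_nine_classes D.L _ (D.smul_periodLattice_le _ (cuspSymbol_mem_periodLattice D.f γ))
    -- choose, for each of the nine classes, a representative in `Γ₀(N)` if the class is hit (else `1`)
    have hrep : ∀ p : Fin 3 × Fin 3, ∃ g : Gamma0 N, (∃ γ : Gamma0 N, ∃ ν ∈ D.L.lattice,
        (D.c : ℂ) * cuspSymbol D.f γ - ((p.1 : ℕ) : ℂ) * D.L.ω₁ - ((p.2 : ℕ) : ℂ) * D.L.ω₂ = 3 * ν) →
        ∃ ν ∈ D.L.lattice, (D.c : ℂ) * cuspSymbol D.f g - ((p.1 : ℕ) : ℂ) * D.L.ω₁ - ((p.2 : ℕ) : ℂ) * D.L.ω₂ = 3 * ν := by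
      intro p
      by_cases h : ∃ γ : Gamma0 N, ∃ ν ∈ D.L.lattice,
          (D.c : ℂ) * cuspSymbol D.f γ - ((p.1 : ℕ) : ℂ) * D.L.ω₁ - ((p.2 : ℕ) : ℂ) * D.L.ω₂ = 3 * ν
      · obtain ⟨γ, hγ⟩ := h; exact ⟨γ, fun _ ↦ hγ⟩
      · exact ⟨1, fun h' ↦ absurd h' h⟩
    choose rep hrep using hrep
    have hcoset : ∀ γ : Gamma0 N, ∃ p : Fin 3 × Fin 3, ((rep p : SL(2, ℤ)))⁻¹ * (γ : SL(2, ℤ)) ∈ Γ := by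
      intro γ
      obtain ⟨i, j, hi, hj, ν, hν, e⟩ := hcl γ
      set p : Fin 3 × Fin 3 := (⟨i, hi⟩, ⟨j, hj⟩) with hp
      obtain ⟨ν', hν', e'⟩ := hrep p ⟨γ, ν, hν, by rw [hp]; exact e⟩
      refine ⟨p, (hmem ((rep p)⁻¹ * γ)).mpr ⟨ν - ν', sub_mem hν hν', ?_⟩⟩
      rw [cuspSymbol_mul_holds, cuspSymbol_inv]
      have e'' : (D.c : ℂ) * cuspSymbol D.f (rep p) - (i : ℂ) * D.L.ω₁ - (j : ℂ) * D.L.ω₂ = 3 * ν' := by rw [hp] at e'; exact e'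
      linear_combination e - e''
    haveI : Finite (SL(2, ℤ) ⧸ Γ) := by
      refine Finite.of_surjective
        (fun q : (SL(2, ℤ) ⧸ Gamma0 N) × (Fin 3 × Fin 3) ↦ (QuotientGroup.mk (q.1.out * (rep q.2 : SL(2, ℤ))) : SL(2, ℤ) ⧸ Γ)) ?_
      intro q
      induction q using QuotientGroup.induction_on with
      | H g =>
        obtain ⟨h, hh⟩ := QuotientGroup.mk_out_eq_mul (Gamma0 N) g
        obtain ⟨p, hδ⟩ := hcoset h⁻¹
        refine ⟨(QuotientGroup.mk g, p), ?_⟩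
        show (QuotientGroup.mk ((QuotientGroup.mk g : SL(2, ℤ) ⧸ Gamma0 N).out * (rep p : SL(2, ℤ))) : SL(2, ℤ) ⧸ Γ) =
          QuotientGroup.mk g
        rw [QuotientGroup.eq, hh]
        have e : ((g : SL(2, ℤ)) * (h : SL(2, ℤ)) * (rep p : SL(2, ℤ)))⁻¹ * g =
            ((rep p : SL(2, ℤ)))⁻¹ * ((h⁻¹ : Gamma0 N) : SL(2, ℤ)) := by
          rw [Subgroup.coe_inv]; group
        rw [e]; exact hδ
    exact Subgroup.finiteIndex_of_finite_quotient
  · -- NORMAL in `Γ₀(N)`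
    rintro g hg γ ⟨hγ, ν, hν, e⟩
    have hmemg : g * γ * g⁻¹ ∈ Gamma0 N := (Gamma0 N).mul_mem ((Gamma0 N).mul_mem hg hγ) ((Gamma0 N).inv_mem hg)
    refine ⟨hmemg, ν, hν, ?_⟩
    have : (⟨g * γ * g⁻¹, hmemg⟩ : Gamma0 N) = ⟨g, hg⟩ * ⟨γ, hγ⟩ * ⟨g, hg⟩⁻¹ := rfl
    rw [this, cuspSymbol_mul_holds, cuspSymbol_mul_holds, cuspSymbol_inv, ← e]; ring
  · -- trace `±2` ⟹ zero discriminant ⟹ zero period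
    intro γ hγ htr
    refine ⟨hγ, 0, zero_mem _, ?_⟩
    have hdet : ((γ : Matrix (Fin 2) (Fin 2) ℤ)).det = 1 := γ.2
    have hdisc : ((((⟨γ, hγ⟩ : Gamma0 N) : SL(2, ℤ)) : Matrix (Fin 2) (Fin 2) ℤ)).discr = 0 := by
      show ((γ : Matrix (Fin 2) (Fin 2) ℤ)).discr = 0
      rw [Matrix.discr_fin_two, Matrix.trace_fin_two, hdet]
      rcases htr with h | h <;> rw [h] <;> norm_num
    rw [cuspSymbol_eq_zero_of_discr_eq_zero D.f hdisc]; simp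

/-! ## §2 `Γ₁(N) ≤ Γ^{(3)}` is the index-`9` configuration; otherwise `Γ^{(3)}` is noncongruence -/

omit [W.IsElliptic] [W.IsGloballyMinimal] in
/-- For a LATTICE-OPTIMAL datum at `9 ∣ N`: `c·{∞,γ∞}_f ∈ 3Λ_W` for every `γ ∈ Γ₁(N)` ⟺ `Λ₁(f) = 3Λ₀(f)` (index `9`). -/
theorem gamma1_thirding_iff_indexNine (D : ModularParametrizationData W N)
    (hopt : ∀ z ∈ D.L.lattice, ∃ w ∈ periodLattice D.f, z = D.c * w) (h9 : 3 ^ 2 ∣ N) :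
    (∀ γ : Gamma1 N, ∃ ν ∈ D.L.lattice,
        (D.c : ℂ) * cuspSymbol D.f ⟨(γ : SL(2, ℤ)), Gamma1_in_Gamma0 N γ.2⟩ = 3 * ν) ↔
      ∀ z : ℂ, z ∈ periodLatticeGamma1 D.f ↔ ∃ w ∈ periodLattice D.f, z = 3 * w := by
  have hc : (D.c : ℂ) ≠ 0 := D.cast_c_ne_zero
  constructor
  · intro h z
    constructor
    · intro hz
      -- closure induction over the `Γ₁(N)`-symbols generating `Λ₁(f)`
      have key : ∀ z ∈ periodLatticeGamma1 D.f, ∃ ν ∈ D.L.lattice, (D.c : ℂ) * z = 3 * ν := by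
        intro z hz
        induction hz using AddSubgroup.closure_induction with
        | mem x hx =>
          obtain ⟨γ, rfl⟩ := hx
          exact h γ
        | zero => exact ⟨0, zero_mem _, by simp⟩
        | add x y _ _ hx hy =>
          obtain ⟨ν₁, hν₁, e₁⟩ := hx
          obtain ⟨ν₂, hν₂, e₂⟩ := hy
          exact ⟨ν₁ + ν₂, add_mem hν₁ hν₂, by rw [mul_add, e₁, e₂]; ring⟩
        | neg x _ hx =>
          obtain ⟨ν, hν, e⟩ := hx
          exact ⟨-ν, neg_mem hν, by rw [mul_neg, e]; ring⟩
      obtain ⟨ν, hν, e⟩ := key z hz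
      obtain ⟨w, hw, hw'⟩ := hopt ν hν
      refine ⟨w, hw, mul_left_cancel₀ hc ?_⟩
      rw [e, hw']; ring
    · rintro ⟨w, hw, rfl⟩
      have h := pMulLatticeLeGamma1OfTracelessPrime_holds N D.f D.isNewformOf.1 3 Nat.prime_three
        ((dvd_pow_self 3 two_ne_zero).trans h9) (D.isNewformOf.1.cuspCoeff_eq_zero_of_sq_dvd Nat.prime_three h9) w hw
      exact_mod_cast h
  · intro hidx γ
    have hz := cuspSymbol_mem_periodLatticeGamma1 D.f γ
    obtain ⟨w, hw, hw'⟩ := (hidx _).mp hz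
    exact ⟨(D.c : ℂ) * w, D.smul_periodLattice_le w hw, by rw [hw']; ring⟩

omit [W.IsElliptic] [W.IsGloballyMinimal] in
/-- **The thirding cover is NONCONGRUENCE** (Kurth–Long Prop. 18 = tree `typeIINoncongruence_holds`): for a lattice-optimal datum at `9 ∣ N` with
`Λ₁(f) ≠ 3Λ₀(f)` (always, see §4), no principal congruence subgroup `Γ(M)` lies in `Γ^{(3)}`. [cite: KurthLong2008, Prop. 18] -/
theorem thirdingCover_noncongruence (D : ModularParametrizationData W N)
    (hopt : ∀ z ∈ D.L.lattice, ∃ w ∈ periodLattice D.f, z = D.c * w) (h9 : 3 ^ 2 ∣ N)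
    (hidx : ¬ ∀ z : ℂ, z ∈ periodLatticeGamma1 D.f ↔ ∃ w ∈ periodLattice D.f, z = 3 * w)
    {Γ : Subgroup SL(2, ℤ)}
    (hmem : ∀ γ : Gamma0 N, (γ : SL(2, ℤ)) ∈ Γ ↔ ∃ ν ∈ D.L.lattice, (D.c : ℂ) * cuspSymbol D.f γ = 3 * ν)
    (hle : Γ ≤ Gamma0 N) (hfi : Γ.FiniteIndex) (hnorm : ∀ g ∈ Gamma0 N, ∀ γ ∈ Γ, g * γ * g⁻¹ ∈ Γ)
    (htr : ∀ γ ∈ Gamma0 N, (γ 0 0 + γ 1 1 = 2 ∨ γ 0 0 + γ 1 1 = -2) → γ ∈ Γ) :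
    ∀ M : ℕ, 0 < M → ¬ CongruenceSubgroup.Gamma M ≤ Γ := by
  have hN : 0 < N := Nat.pos_of_ne_zero (NeZero.ne N)
  have h1 : ¬ Gamma1 N ≤ Γ := by
    intro h1
    apply hidx
    exact (gamma1_thirding_iff_indexNine D hopt h9).mp fun γ ↦ (hmem _).mp (h1 γ.2)
  exact typeIINoncongruence_holds N hN Γ hfi hle hnorm htr h1

/-! ## §3 The UDC glue: a thirding witness with algebraic-integer `q`-expansion forces index `9` -/

omit [W.IsElliptic] [W.IsGloballyMinimal] in
/-- **Thirding witness ∧ Unbounded Denominators ⟹ index `9`** (for a lattice-optimal datum at `9 ∣ N`): a holomorphic weight-`k` `F` with `Γ₀(N)`-stabiliser EXACTLY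
`Γ^{(3)}`, exponential growth at the cusps and algebraic-integer `q`-expansion makes `Γ^{(3)} ⊇ Γ(MN)` congruence, hence `Λ₁(f) = 3Λ₀(f)`.
[cite: CalegariDimitrovTang2025, Thm. 1.0.1] [cite: KurthLong2008, Prop. 18] -/
theorem indexNine_of_thirdingWitness_of_UDW (D : ModularParametrizationData W N)
    (hopt : ∀ z ∈ D.L.lattice, ∃ w ∈ periodLattice D.f, z = D.c * w) (h9 : 3 ^ 2 ∣ N) {k : ℤ}
    (hUDW : UnboundedDenominatorsWeightAlgInt k) {F : UpperHalfPlane → ℂ} (hhol : MDifferentiable 𝓘(ℂ) 𝓘(ℂ) F)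
    (hinv : ∀ γ : Gamma0 N, (∃ ν ∈ D.L.lattice, (D.c : ℂ) * cuspSymbol D.f γ = 3 * ν) → F ∣[k] (γ : SL(2, ℤ)) = F)
    (hstab : ∀ γ : Gamma0 N, F ∣[k] (γ : SL(2, ℤ)) = F → ∃ ν ∈ D.L.lattice, (D.c : ℂ) * cuspSymbol D.f γ = 3 * ν)
    (hgrowth : ∀ g : SL(2, ℤ), ∃ C A m : ℝ, ∀ τ : UpperHalfPlane, A ≤ τ.im → ‖(F ∣[k] g) τ‖ ≤ C * Real.exp (m * τ.im))
    (hq : ∃ b : ℕ → ℂ, (∀ n, IsIntegral ℤ (b n)) ∧ ∀ τ : UpperHalfPlane,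
      HasSum (fun n : ℕ ↦ b n * Complex.exp (2 * Real.pi * Complex.I * (τ : ℂ) * n)) (F τ)) :
    ∀ z : ℂ, z ∈ periodLatticeGamma1 D.f ↔ ∃ w ∈ periodLattice D.f, z = 3 * w := by
  obtain ⟨Γ, hmem, hle, hfi, hnorm, htr⟩ := exists_thirdingCoverSubgroup D
  have hN : 0 < N := Nat.pos_of_ne_zero (NeZero.ne N)
  have hΓinv : ∀ γ ∈ Γ, F ∣[k] γ = F := by
    intro γ hγ
    have hγ0 : γ ∈ Gamma0 N := hle hγ
    exact hinv ⟨γ, hγ0⟩ ((hmem ⟨γ, hγ0⟩).mp hγ)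
  obtain ⟨M, hM, hcong⟩ := hUDW Γ hfi F hhol hΓinv hgrowth hq
  by_contra hidx
  -- `Γ(MN) ≤ Γ^{(3)}`
  have hΓMN : CongruenceSubgroup.Gamma (M * N) ≤ Γ := by
    intro g hg
    have hgN : g ∈ CongruenceSubgroup.Gamma N := Gamma_mul_le_right M N hg
    have hgM : g ∈ CongruenceSubgroup.Gamma M := Gamma_mul_le_left M N hg
    have hg0 : g ∈ Gamma0 N := Gamma_le_Gamma0 N hgN
    exact (hmem ⟨g, hg0⟩).mpr (hstab ⟨g, hg0⟩ (hcong g hgM))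
  exact thirdingCover_noncongruence D hopt h9 hidx hmem hle hfi hnorm htr (M * N) (Nat.mul_pos hM hN) hΓMN

/-! ## §4 C3 ⟸ CDT ∧ THIRDING WITNESS LAW (index `9` never occurs) -/

/-- **C3 for one datum ⟸ CDT ∧ thirding witness.**  `hTW` is the THIRDING WITNESS LAW (OPEN analytic stub; on paper `F = t(⅓φ)·B_d·f^a·Δ^m`, Honda at `c/3`):
for every lattice-optimal datum at `9 ∣ N` with `3 ∣ c` a holomorphic weight-`k` witness with `Γ₀(N)`-stabiliser `Γ^{(3)}`, exponential growth at the cusps and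
algebraic-integer `q`-expansion.  The index-`9` configuration it would force is excluded UNCONDITIONALLY (`not_periodLatticeGamma1_eq_three_mul_periodLattice`).
[cite: CalegariDimitrovTang2025, Thm. 1.0.1 and Remarks 58–59] [cite: Stevens1989, §2] -/
theorem not_three_dvd_maninConstant_of_CDT_of_thirdingWitnessLaw
    (hCDT : Literature.NumberTheory.Automorphic.CalegariDimitrovTang2025_unboundedDenominators_algInt)
    (hTW : ∀ (W : WeierstrassCurve ℚ) [W.IsElliptic] [W.IsGloballyMinimal] {N : ℕ} [NeZero N] (D : ModularParametrizationData W N),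
      3 ^ 2 ∣ N → (∀ z ∈ D.L.lattice, ∃ w ∈ periodLattice D.f, z = D.c * w) → (3 : ℤ) ∣ D.c →
      ∃ (k : ℤ) (F : UpperHalfPlane → ℂ), MDifferentiable 𝓘(ℂ) 𝓘(ℂ) F ∧
        (∀ γ : Gamma0 N, (∃ ν ∈ D.L.lattice, (D.c : ℂ) * cuspSymbol D.f γ = 3 * ν) → F ∣[k] (γ : SL(2, ℤ)) = F) ∧
        (∀ γ : Gamma0 N, F ∣[k] (γ : SL(2, ℤ)) = F → ∃ ν ∈ D.L.lattice, (D.c : ℂ) * cuspSymbol D.f γ = 3 * ν) ∧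
        (∀ g : SL(2, ℤ), ∃ C A m : ℝ, ∀ τ : UpperHalfPlane, A ≤ τ.im → ‖(F ∣[k] g) τ‖ ≤ C * Real.exp (m * τ.im)) ∧
        (∃ b : ℕ → ℂ, (∀ n, IsIntegral ℤ (b n)) ∧ ∀ τ : UpperHalfPlane,
          HasSum (fun n : ℕ ↦ b n * Complex.exp (2 * Real.pi * Complex.I * (τ : ℂ) * n)) (F τ)))
    (D : ModularParametrizationData W N) (h9 : 3 ^ 2 ∣ N) (hopt : ∀ z ∈ D.L.lattice, ∃ w ∈ periodLattice D.f, z = D.c * w) :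
    ¬ (3 : ℤ) ∣ D.maninConstant := by
  intro h3c
  obtain ⟨k, F, hhol, hinv, hstab, hgrowth, hq⟩ := hTW W D h9 hopt h3c
  exact not_periodLatticeGamma1_eq_three_mul_periodLattice D hopt
    (indexNine_of_thirdingWitness_of_UDW D hopt h9 (UDWOfCDT.unboundedDenominatorsWeightAlgInt_of_CDT_algInt hCDT k)
      hhol hinv hstab hgrowth hq)

/-- **THE THIRDING SKELETON'S COMPOSITION: C3 `ManinPrimeToThreeAtNine` ⟸ CDT ∧ THIRDING WITNESS LAW** — two inputs, one printed and one analytic; the crux's four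
printed-fact binders are not used; no Kato fact, no cusp fact, no `3`-torsion hypothesis, no index law.  CONDITIONAL on the two inputs; C3, Manin's conjecture
and BSD are not proved by this. [cite: CalegariDimitrovTang2025, Thm. 1.0.1] [cite: KurthLong2008, Prop. 18] -/
theorem maninPrimeToThreeAtNine_of_CDT_thirdingWitnessLaw
    (hCDT : Literature.NumberTheory.Automorphic.CalegariDimitrovTang2025_unboundedDenominators_algInt)
    (hTW : ∀ (W : WeierstrassCurve ℚ) [W.IsElliptic] [W.IsGloballyMinimal] {N : ℕ} [NeZero N] (D : ModularParametrizationData W N),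
      3 ^ 2 ∣ N → (∀ z ∈ D.L.lattice, ∃ w ∈ periodLattice D.f, z = D.c * w) → (3 : ℤ) ∣ D.c →
      ∃ (k : ℤ) (F : UpperHalfPlane → ℂ), MDifferentiable 𝓘(ℂ) 𝓘(ℂ) F ∧
        (∀ γ : Gamma0 N, (∃ ν ∈ D.L.lattice, (D.c : ℂ) * cuspSymbol D.f γ = 3 * ν) → F ∣[k] (γ : SL(2, ℤ)) = F) ∧
        (∀ γ : Gamma0 N, F ∣[k] (γ : SL(2, ℤ)) = F → ∃ ν ∈ D.L.lattice, (D.c : ℂ) * cuspSymbol D.f γ = 3 * ν) ∧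
        (∀ g : SL(2, ℤ), ∃ C A m : ℝ, ∀ τ : UpperHalfPlane, A ≤ τ.im → ‖(F ∣[k] g) τ‖ ≤ C * Real.exp (m * τ.im)) ∧
        (∃ b : ℕ → ℂ, (∀ n, IsIntegral ℤ (b n)) ∧ ∀ τ : UpperHalfPlane,
          HasSum (fun n : ℕ ↦ b n * Complex.exp (2 * Real.pi * Complex.I * (τ : ℂ) * n)) (F τ))) :
    Summit.BirchSwinnertonDyer.BirchSwinnertonDyer.Theses.ManinLocalTwoThree.ManinPrimeToThreeAtNine := by
  intro _hM _hAU _hC _hnf W _ _ N _ D hopt h9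
  exact not_three_dvd_maninConstant_of_CDT_of_thirdingWitnessLaw hCDT hTW D h9 hopt

end Summit.BirchSwinnertonDyer.BirchSwinnertonDyer.Theorems.ManinLocalTwoThree.Thirding

end
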